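import Summits.QuantumFields.BalabanUV.T4Continuum.Support.RegionGaugeFixedVector
import Summits.QuantumFields.BalabanUV.T4Continuum.Support.DirichletMonotoneCutoffBounds

/-!
# `BalabanUV.T4Continuum.Support.RegionBlockExtension` — NE2 (node U1a) formalisation swarm, SUPPLIER item «Δ1-COERC-ORTH» under the
# owner's sub-row `T4-U1a.S-NE2-D1-DIRICHLET°` (vector layer, W1): THE TWO-SCALE EXTENSION OPERATOR ON A UNION OF UNIT BLOCKS — every
# block function `g` on `S` has a Dirichlet extension `E g` to the sites of `Ω = blockReg n M S` with EXACT block averages `Q′_Ω(E g) = g`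
# whose fine Dirichlet energy is bounded by `n^d` times the COARSE Dirichlet energy of `g` (unit b2b-balaban-t4-ne2-formalise-leaf-09, gen 8, v1)

HONEST FRAMING (T4-DAG p. 1).  [folklore] `U = 1` lattice calculus on ONE region (any decidable set `S` of unit blocks), finite torus,
`2 ≤ n`; nothing printed is a hypothesis; NE2 (U1a) NOT proved; spine PROVED 0/9 unchanged; NOT [B9] (3.23)–(3.27) as printed; NOT infinite
volume, NOT the mass gap, NOT Clay.  HONEST DEPENDENCY (verbatim): «continuum YM on T⁴ ⇐ BetaPertH ∧ nine spine estimates (0/9 proved);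
BetaPertH ⇐ (D1) ∧ (D4) ∧ CAP+tail; G-an2-4 gates asym, D1 and NE2/3/4.»

WHY (memo `t4/T4-EST-NE2-D1-COERC.md` §6 route (r4); leaf-09-g8's `RegionGaugeSliceOrth(Region)`): the displayed W1 inequality is now
`OrthSliceCoercive` — coercivity of `‖curl A‖² + a n^d‖QA‖²` on fields with block-constant region divergence.  Its GRADIENT sector
(`A = ∂_Ωφ` with `∂_Ωᴴ∂_Ωφ` block-constant) is the two-scale elliptic estimate `nsq (∂_Ωφ) ≤ C·n^d·nsq (Q∂_Ωφ)`, which follows by ONE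
Cauchy–Schwarz from an extension operator with exact block averages and the energy bound below (`RegionGradientTwoScale`, next file).
THIS FILE builds the operator from leaf-08-g3's vertex bumps (`DirichletMonotoneCutoff.bump`, an exact partition of unity with first
differences `≤ 3/(n−1)`) and leaf-09-g1's in-block trial function (`ScalarBlockTrialFunction.trial`, `Q′ψ_φ = β₁^d·φ`):

 * §1 corner offsets `upB σ` (`σ ∈ {0,1}^d`), the vertex value `vertexVal g v` = the mean of `g` over the `2^d` blocks `v − upB τ` of the
   patch of `v` if ALL of them lie in `S`, else `0`; the interpolant `interp g = Σ_v vertexVal g v · bump v`; the residual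
   `resid g = g − Q′(interp g)` on `S`; the extension `extFun g = interp g + trial (ext (β₁^{−d}·resid g))` and `blockExt g = extFun g|_Ω`.
 * §2 SUPPORT and EXACTNESS: `interp g`, `extFun g` vanish off `Ω` (a bump meeting a block outside `S` has a non-interior vertex);
   `ext Ω (blockExt g) = extFun g`; **`QOm_blockExt`**: `Q′_Ω(E g) = g` EXACTLY.
 * §3 THE PATCH PATH LEMMA: `‖g̃(v − upB τ) − g̃(v − upB τ′)‖ ≤ 2·P g v`, `P g v = Σ_τ Σ_ν ‖∇₁g̃ (v − upB τ, ν)‖` (telescoping through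
   the corners of the patch; `g̃ = ext S g`, `∇₁ = GradOp M 1`), hence `‖g̃ b − vertexVal g v‖ ≤ 2·P g v` for every block `b` of the patch.
 * §4 THE RESIDUAL BOUND: `‖resid g y‖ ≤ Bsum g y` (`Bsum g y = Σ_σ P g (y + upB σ)`, the patch edge sums of the `2^d` vertices of `y`).
 File 2 (`RegionBlockExtensionEnergy`) adds the gradient bound of the interpolant, the counting `Σ_v (P g v)² ≤ 4^d·d·nsq (∇₁g̃)` and
 THE END `dirichlet (extFun g) ≤ Cext d · n^d · nsq (∇₁g̃)` — uniform in `n ≥ 2`, `M` and `S`.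

ABSOLUTE RULE (cell, verbatim): «No internally-minted statement may enter as a cited fact. Every hypothesis is either kernel-proved in
this package or a verbatim quotation of a PUBLISHED theorem with page reference. The manuscript(s) under audit are NOT citable for
their own disputed steps — they are the thing under adjudication; programme-internal (2001/route/tribunal) claims are never citable.»
[folklore] throughout (a Clément/Scott–Zhang-type quasi-interpolant with an exact-average correction, on the cubical lattice); data defs
only, no `def … : Prop`.  NOT CLAIMED: anything about the vector field `A` beyond its gradient sector; NE2; NE3; «not in print; our construction».
-/

noncomputable section

open scoped BigOperators ComplexConjugate Matrix
open Finset

namespace Summit.QuantumFields.BalabanUV.T4Continuum.RegionBlockExtension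

open Literature.MathematicalPhysics.QuantumFieldTheory.Balaban1983to89.B5Prop11Plancherel (Tor fine unitVec)
open Literature.MathematicalPhysics.QuantumFieldTheory.Balaban1983to89.B5Prop11Lower (nsq nsq_nonneg)
open Literature.MathematicalPhysics.QuantumFieldTheory.Balaban1983to89.B5Action121 (sdiff GradOp GradOp_mulVec sdiff_mulVec)
open Literature.MathematicalPhysics.QuantumFieldTheory.Balaban1983to89.B5Block118 (bpt QsOp QsOp_mulVec)
open Literature.MathematicalPhysics.QuantumFieldTheory.Balaban1983to89.B5Blocks16 (blockOf blockOf_bpt sum_blocks)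
open Literature.MathematicalPhysics.QuantumFieldTheory.Balaban1983to89.B5AverageCurlStokes (sum_blocks_real)
open Summit.QuantumFields.BalabanUV.T4Continuum
open Summit.QuantumFields.BalabanUV.T4Continuum.SubtypeCompression (ext ext_apply_of ext_apply_of_not nsq_ext)
open Summit.QuantumFields.BalabanUV.T4Continuum.ScalarBlockPoincare (nsq_add_le nsq_smul)
open Summit.QuantumFields.BalabanUV.T4Continuum.ScalarAveragedPropagator (dirichlet nsq_GradOp_mulVec)
open Summit.QuantumFields.BalabanUV.T4Continuum.ScalarBlockTrialFunction (trial beta1 beta1_ge QsOp_trial nsq_trial_le dirichlet_trial_le)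
open Summit.QuantumFields.BalabanUV.T4Continuum.DirichletMonotoneCutoff (offsF bump sum_bump bump_mem InPatch inPatch_of_bump_ne_zero
  sum_abs_bump_sub_le)
open Summit.QuantumFields.BalabanUV.T4Continuum.RegionScalarCompression (QOm trial_ext_apply_of_not)
open Summit.QuantumFields.BalabanUV.T4Continuum.RegionGaugeFixedVector (gradR grad₁R)
open Summit.QuantumFields.BalabanUV.Beta.GAN24.DirichletBoxCompression (toBlock_mulVec')
open Summit.QuantumFields.BalabanUV.Beta.GAN24.DirichletBoxTrace (blockReg)

variable {d : ℕ} (n : ℕ) [NeZero n] (M : Fin d → ℕ) [hM : ∀ μ, NeZero (M μ)] (S : Tor M → Prop) [DecidablePred S]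

/-! ## §1 The objects -/

/-- the corner offset `σ ∈ {0,1}^d` read as a unit-torus vector. [folklore] -/
def upB (σ : Fin d → Fin 2) : Tor M := fun ν => ((σ ν : ℕ) : ZMod (M ν))

/-- the VERTEX VALUE: the mean of `g` over the `2^d` blocks `v − upB τ` of the patch of the vertex `v` if the whole patch lies in `S`,
and `0` otherwise (so that the interpolant vanishes off `Ω`). [folklore] -/
def vertexVal (g : {y // S y} → ℂ) (v : Tor M) : ℂ :=
  if (∀ τ : Fin d → Fin 2, S (v - upB M τ)) then ((2 : ℂ) ^ d)⁻¹ * ∑ τ : Fin d → Fin 2, ext S g (v - upB M τ) else 0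

/-- the INTERPOLANT `ψ₀ = Σ_v G(v)·bump_v`. [folklore] -/
def interp (g : {y // S y} → ℂ) : Tor (fine n M) → ℂ := fun x => ∑ v : Tor M, vertexVal M S g v * ((bump n M v x : ℝ) : ℂ)

/-- the RESIDUAL of the block averages: `r = g − Q′ψ₀` on `S`. [folklore] -/
def resid (g : {y // S y} → ℂ) : {y // S y} → ℂ := fun y => g y - (QsOp n M *ᵥ interp n M S g) (y : Tor M)

/-- the EXTENSION on the torus: `ψ = ψ₀ + trial (ext (β₁^{−d}·r))` (leaf-09-g1's in-block trial function fixes the averages). [folklore] -/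
def extFun (g : {y // S y} → ℂ) : Tor (fine n M) → ℂ :=
  interp n M S g + trial n M (ext S fun y => ((((beta1 n) ^ d : ℝ) : ℂ)⁻¹) * resid n M S g y)

/-- **THE EXTENSION OPERATOR** `E g` on the sites of `Ω = blockReg n M S`. [folklore] -/
def blockExt (g : {y // S y} → ℂ) : {x // blockReg n M S x} → ℂ := fun x => extFun n M S g x

/-! ## §2 Support and exactness -/

omit hM [DecidablePred S] in
/-- a block of the patch of `v` is `v − upB τ` for some corner offset `τ`. [folklore] -/
theorem exists_eq_sub_upB_of_inPatch {v b : Tor M} (h : InPatch M v b) : ∃ τ : Fin d → Fin 2, b = v - upB M τ := by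
  classical
  refine ⟨fun ν => if v ν = b ν + 1 then 1 else 0, funext fun ν => ?_⟩
  simp only [Pi.sub_apply, upB]
  split_ifs with h1
  · rw [h1]; simp
  · rcases h ν with h' | h'
    · exact absurd h' h1
    · rw [h']; simp

omit hM [DecidablePred S] in
/-- dually, a vertex of the block `y` is `y + upB σ`. [folklore] -/
theorem exists_eq_add_upB_of_inPatch {v y : Tor M} (h : InPatch M v y) : ∃ σ : Fin d → Fin 2, v = y + upB M σ := by
  classical
  refine ⟨fun ν => if v ν = y ν + 1 then 1 else 0, funext fun ν => ?_⟩
  simp only [Pi.add_apply, upB]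
  split_ifs with h1
  · rw [h1]; simp
  · rcases h ν with h' | h'
    · exact absurd h' h1
    · rw [h']; simp

omit hM in
/-- a vertex whose patch contains a block outside `S` has vertex value `0`. [folklore] -/
theorem vertexVal_eq_zero (g : {y // S y} → ℂ) {v b : Tor M} (h : InPatch M v b) (hb : ¬ S b) : vertexVal M S g v = 0 := by
  obtain ⟨τ, rfl⟩ := exists_eq_sub_upB_of_inPatch M h
  unfold vertexVal
  rw [if_neg]
  exact fun hall => hb (hall τ)

/-- **the interpolant vanishes off `Ω`**. [folklore] -/
theorem interp_apply_of_not (g : {y // S y} → ℂ) {x : Tor (fine n M)} (hx : ¬ blockReg n M S x) : interp n M S g x = 0 := by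
  unfold interp
  refine Finset.sum_eq_zero fun v _ => ?_
  by_cases hb : bump n M v x = 0
  · rw [hb, Complex.ofReal_zero, mul_zero]
  · rw [vertexVal_eq_zero M S g (inPatch_of_bump_ne_zero n M hb) hx, zero_mul]

/-- **the extension vanishes off `Ω`**. [folklore] -/
theorem extFun_apply_of_not (g : {y // S y} → ℂ) {x : Tor (fine n M)} (hx : ¬ blockReg n M S x) : extFun n M S g x = 0 := by
  rw [extFun, Pi.add_apply, interp_apply_of_not n M S g hx, trial_ext_apply_of_not n M S _ hx, add_zero]

/-- hence extending `E g` by zero gives back `extFun g`. [folklore] -/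
theorem ext_blockExt (g : {y // S y} → ℂ) : ext (blockReg n M S) (blockExt n M S g) = extFun n M S g := by
  funext x
  by_cases hx : blockReg n M S x
  · exact ext_apply_of (blockReg n M S) (blockExt n M S g) ⟨x, hx⟩
  · rw [ext_apply_of_not _ _ hx, extFun_apply_of_not n M S g hx]

/-- **EXACT BLOCK AVERAGES**: `Q′_Ω(E g) = g`. [folklore] -/
theorem QOm_blockExt (g : {y // S y} → ℂ) : QOm n M S *ᵥ blockExt n M S g = g := by
  have hβ : ((((beta1 n) ^ d : ℝ) : ℂ)) ≠ 0 := by exact_mod_cast (pow_pos (beta1_ge n).2 d).ne'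
  unfold QOm
  rw [toBlock_mulVec', ext_blockExt]
  funext y
  rw [extFun, Matrix.mulVec_add, Pi.add_apply, QsOp_trial, Pi.smul_apply, smul_eq_mul, ext_apply_of, ← mul_assoc,
    mul_inv_cancel₀ hβ, one_mul, resid, add_sub_cancel]

/-! ## §3 The patch path lemma -/

/-- the PATCH EDGE SUM `P g v = Σ_τ Σ_ν ‖(∇₁g̃)(v − upB τ, ν)‖` (`g̃ = ext S g`, `∇₁ = GradOp M 1`). [folklore] -/
def P (g : {y // S y} → ℂ) (v : Tor M) : ℝ := ∑ τ : Fin d → Fin 2, ∑ ν : Fin d, ‖(GradOp M 1 *ᵥ ext S g) (v - upB M τ, ν)‖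

/-- `0 ≤ P`. [folklore] -/
theorem P_nonneg (g : {y // S y} → ℂ) (v : Tor M) : 0 ≤ P M S g v :=
  Finset.sum_nonneg fun _ _ => Finset.sum_nonneg fun _ _ => norm_nonneg _

/-- the unit gradient of the zero-extension: `(∇₁g̃)(b, ν) = g̃(b + e_ν) − g̃(b)`. [folklore] -/
theorem grad_ext_apply (g : {y // S y} → ℂ) (b : Tor M) (ν : Fin d) :
    (GradOp M 1 *ᵥ ext S g) (b, ν) = ext S g (b + unitVec M ν) - ext S g b := by
  rw [GradOp_mulVec, sdiff_mulVec, one_mul]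

omit hM in
/-- lowering the `μ`-th corner coordinate moves the block up by `e_μ`: `v − upB ρ[μ ↦ 0] = (v − upB ρ[μ ↦ 1]) + e_μ`. [folklore] -/
theorem sub_upB_update_zero (v : Tor M) (ρ : Fin d → Fin 2) (μ : Fin d) :
    v - upB M (Function.update ρ μ 0) = (v - upB M (Function.update ρ μ 1)) + unitVec M μ := by
  funext ν
  simp only [Pi.sub_apply, Pi.add_apply, upB, unitVec]
  by_cases h : ν = μ
  · subst h; simp
  · simp [h]

/-- **ONE FLIP COSTS ONE EDGE**: `‖g̃(v − upB ρ[μ ↦ a]) − g̃(v − upB ρ[μ ↦ a′])‖ ≤ ‖(∇₁g̃)(v − upB ρ[μ ↦ 1], μ)‖`. [folklore] -/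
theorem norm_sub_flip_le (g : {y // S y} → ℂ) (v : Tor M) (ρ : Fin d → Fin 2) (μ : Fin d) (a a' : Fin 2) :
    ‖ext S g (v - upB M (Function.update ρ μ a)) - ext S g (v - upB M (Function.update ρ μ a'))‖
      ≤ ‖(GradOp M 1 *ᵥ ext S g) (v - upB M (Function.update ρ μ 1), μ)‖ := by
  rw [grad_ext_apply, ← sub_upB_update_zero]
  fin_cases a <;> fin_cases a'
  · simp
  · simp only [Fin.zero_eta, Fin.mk_one]; exact le_rfl
  · simp only [Fin.zero_eta, Fin.mk_one]; rw [norm_sub_rev]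
  · simp

/-- the chain of corners from `τ` to `τ′`: `τ′` on the coordinates `< k`, `τ` on the rest. [folklore] -/
def mix (k : ℕ) (τ τ' : Fin d → Fin 2) : Fin d → Fin 2 := fun ν => if (ν : ℕ) < k then τ' ν else τ ν

/-- the cost of the `i`-th coordinate flip: the direction-`i` part of the patch edge sum (`0` for `i ≥ d`). [folklore] -/
def cost (g : {y // S y} → ℂ) (v : Tor M) (i : ℕ) : ℝ :=
  ∑ ρ : Fin d → Fin 2, ∑ ν : Fin d, if (ν : ℕ) = i then ‖(GradOp M 1 *ᵥ ext S g) (v - upB M ρ, ν)‖ else 0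

/-- for `k < d` the cost is the sum over the corners of the direction-`k` edge differences. [folklore] -/
theorem cost_eq (g : {y // S y} → ℂ) (v : Tor M) {k : ℕ} (hk : k < d) :
    cost M S g v k = ∑ ρ : Fin d → Fin 2, ‖(GradOp M 1 *ᵥ ext S g) (v - upB M ρ, ⟨k, hk⟩)‖ := by
  unfold cost
  refine Finset.sum_congr rfl fun ρ _ => ?_
  rw [Finset.sum_eq_single ⟨k, hk⟩ (fun ν _ hν => if_neg fun h => hν (Fin.ext h)) (fun h => absurd (Finset.mem_univ _) h),
    if_pos rfl]

/-- past the last coordinate the cost vanishes. [folklore] -/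
theorem cost_eq_zero (g : {y // S y} → ℂ) (v : Tor M) {k : ℕ} (hk : d ≤ k) : cost M S g v k = 0 := by
  unfold cost
  refine Finset.sum_eq_zero fun ρ _ => Finset.sum_eq_zero fun ν _ => if_neg ?_
  have := ν.isLt; omega

/-- the costs add up to the patch edge sum. [folklore] -/
theorem sum_cost (g : {y // S y} → ℂ) (v : Tor M) : ∑ i ∈ Finset.range d, cost M S g v i = P M S g v := by
  unfold cost P
  rw [Finset.sum_comm]
  refine Finset.sum_congr rfl fun ρ _ => ?_
  rw [Finset.sum_comm]
  refine Finset.sum_congr rfl fun ν _ => ?_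
  rw [Finset.sum_ite_eq, if_pos (Finset.mem_range.mpr ν.isLt)]

/-- one step of the chain costs at most `cost k`. [folklore] -/
theorem norm_chain_step_le (g : {y // S y} → ℂ) (v : Tor M) (τ τ' : Fin d → Fin 2) (k : ℕ) :
    ‖ext S g (v - upB M (mix (k + 1) τ τ')) - ext S g (v - upB M (mix k τ τ'))‖ ≤ cost M S g v k := by
  by_cases hk : k < d
  · have e1 : mix (k + 1) τ τ' = Function.update (mix k τ τ') ⟨k, hk⟩ (τ' ⟨k, hk⟩) := by
      funext ν
      by_cases hν : ν = ⟨k, hk⟩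
      · rw [hν, Function.update_self]; simp [mix]
      · rw [Function.update_of_ne hν]
        have hν' : (ν : ℕ) ≠ k := fun h => hν (Fin.ext h)
        by_cases h1 : (ν : ℕ) < k
        · simp only [mix, if_pos h1, if_pos (show (ν : ℕ) < k + 1 by omega)]
        · simp only [mix, if_neg h1, if_neg (show ¬ (ν : ℕ) < k + 1 by omega)]
    have e2 : v - upB M (mix k τ τ') = v - upB M (Function.update (mix k τ τ') ⟨k, hk⟩ (mix k τ τ' ⟨k, hk⟩)) := by
      rw [Function.update_eq_self]
    rw [cost_eq M S g v hk, e1, e2]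
    refine (norm_sub_flip_le M S g v (mix k τ τ') ⟨k, hk⟩ (τ' ⟨k, hk⟩) (mix k τ τ' ⟨k, hk⟩)).trans ?_
    exact Finset.single_le_sum (f := fun ρ : Fin d → Fin 2 => ‖(GradOp M 1 *ᵥ ext S g) (v - upB M ρ, ⟨k, hk⟩)‖)
      (fun _ _ => norm_nonneg _) (Finset.mem_univ (Function.update (mix k τ τ') ⟨k, hk⟩ 1))
  · have e1 : mix (k + 1) τ τ' = mix k τ τ' := funext fun ν => by
      have h1 : (ν : ℕ) < k := lt_of_lt_of_le ν.isLt (not_lt.mp hk)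
      simp only [mix, if_pos h1, if_pos (show (ν : ℕ) < k + 1 by omega)]
    rw [e1, sub_self, norm_zero, cost_eq_zero M S g v (not_lt.mp hk)]

/-- **THE PATH LEMMA**: any two blocks of the patch of `v` differ in `g̃` by at most the patch edge sum.
`‖g̃(v − upB τ′) − g̃(v − upB τ)‖ ≤ P g v`. [folklore] -/
theorem norm_sub_patch_le (g : {y // S y} → ℂ) (v : Tor M) (τ τ' : Fin d → Fin 2) :
    ‖ext S g (v - upB M τ') - ext S g (v - upB M τ)‖ ≤ P M S g v := by
  have key : ∀ k : ℕ, ‖ext S g (v - upB M (mix k τ τ')) - ext S g (v - upB M τ)‖ ≤ ∑ i ∈ Finset.range k, cost M S g v i := by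
    intro k
    induction k with
    | zero =>
      have h0 : mix 0 τ τ' = τ := funext fun ν => by simp [mix]
      rw [h0, sub_self, norm_zero, Finset.sum_range_zero]
    | succ k ih =>
      rw [Finset.sum_range_succ]
      calc ‖ext S g (v - upB M (mix (k + 1) τ τ')) - ext S g (v - upB M τ)‖
          ≤ ‖ext S g (v - upB M (mix (k + 1) τ τ')) - ext S g (v - upB M (mix k τ τ'))‖
            + ‖ext S g (v - upB M (mix k τ τ')) - ext S g (v - upB M τ)‖ := norm_sub_le_norm_sub_add_norm_sub _ _ _
        _ ≤ cost M S g v k + ∑ i ∈ Finset.range k, cost M S g v i := add_le_add (norm_chain_step_le M S g v τ τ' k) ih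
        _ = ∑ i ∈ Finset.range k, cost M S g v i + cost M S g v k := add_comm _ _
  have hd : mix d τ τ' = τ' := funext fun ν => by simp [mix, ν.isLt]
  have h := key d
  rwa [hd, sum_cost] at h

/-- **every block of the patch is within `P g v` of the vertex value** (interior vertex: a mean of patch values; boundary vertex: the
value `0` is the value of `g̃` at a block of the patch outside `S`). [folklore] -/
theorem norm_sub_vertexVal_le (g : {y // S y} → ℂ) (v : Tor M) (τ₀ : Fin d → Fin 2) :
    ‖ext S g (v - upB M τ₀) - vertexVal M S g v‖ ≤ P M S g v := by
  classical
  unfold vertexVal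
  split_ifs with hall
  · have hcard : (Finset.univ : Finset (Fin d → Fin 2)).card = 2 ^ d := by
      rw [Finset.card_univ, Fintype.card_fun, Fintype.card_fin, Fintype.card_fin]
    have h2 : ((2 : ℂ) ^ d) ≠ 0 := pow_ne_zero _ two_ne_zero
    have e : ext S g (v - upB M τ₀) - ((2 : ℂ) ^ d)⁻¹ * ∑ τ : Fin d → Fin 2, ext S g (v - upB M τ)
        = ((2 : ℂ) ^ d)⁻¹ * ∑ τ : Fin d → Fin 2, (ext S g (v - upB M τ₀) - ext S g (v - upB M τ)) := by
      rw [Finset.sum_sub_distrib, Finset.sum_const, hcard, mul_sub, nsmul_eq_mul]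
      push_cast
      rw [← mul_assoc, inv_mul_cancel₀ h2, one_mul]
    rw [e, norm_mul, norm_inv, norm_pow, Complex.norm_two]
    calc ((2 : ℝ) ^ d)⁻¹ * ‖∑ τ : Fin d → Fin 2, (ext S g (v - upB M τ₀) - ext S g (v - upB M τ))‖
        ≤ ((2 : ℝ) ^ d)⁻¹ * ∑ τ : Fin d → Fin 2, ‖ext S g (v - upB M τ₀) - ext S g (v - upB M τ)‖ :=
          mul_le_mul_of_nonneg_left (norm_sum_le _ _) (by positivity)
      _ ≤ ((2 : ℝ) ^ d)⁻¹ * ∑ _τ : Fin d → Fin 2, P M S g v := by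
          gcongr with τ _
          rw [norm_sub_rev]; exact norm_sub_patch_le M S g v τ₀ τ
      _ = P M S g v := by
          rw [Finset.sum_const, hcard, nsmul_eq_mul]; push_cast
          rw [← mul_assoc, inv_mul_cancel₀ (pow_ne_zero _ two_ne_zero), one_mul]
  · obtain ⟨τ₁, hτ₁⟩ := not_forall.mp hall
    have h := norm_sub_patch_le M S g v τ₁ τ₀
    rwa [ext_apply_of_not S g hτ₁] at h

/-! ## §4 The residual and gradient bounds -/

/-- the BLOCK BOUND `Bsum g y = Σ_σ P g (y + upB σ)` (the patch edge sums of the `2^d` vertices of `y`). [folklore] -/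
def Bsum (g : {y // S y} → ℂ) (y : Tor M) : ℝ := ∑ σ : Fin d → Fin 2, P M S g (y + upB M σ)

/-- `0 ≤ Bsum`. [folklore] -/
theorem Bsum_nonneg (g : {y // S y} → ℂ) (y : Tor M) : 0 ≤ Bsum M S g y := Finset.sum_nonneg fun _ _ => P_nonneg M S g _

/-- a vertex of `y` is within `Bsum g y` of `g̃ y`. [folklore] -/
theorem norm_sub_vertexVal_le_Bsum (g : {y // S y} → ℂ) {v y : Tor M} (h : InPatch M v y) :
    ‖ext S g y - vertexVal M S g v‖ ≤ Bsum M S g y := by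
  obtain ⟨τ₀, hy⟩ := exists_eq_sub_upB_of_inPatch M h
  obtain ⟨σ₀, hv⟩ := exists_eq_add_upB_of_inPatch M h
  have h1 := norm_sub_vertexVal_le M S g v τ₀
  rw [← hy] at h1
  refine h1.trans ?_
  rw [hv]
  exact Finset.single_le_sum (f := fun σ => P M S g (y + upB M σ)) (fun _ _ => P_nonneg M S g _) (Finset.mem_univ σ₀)

/-- **THE RESIDUAL BOUND**: `‖(g − Q′ψ₀)(y)‖ ≤ Bsum g y`. [folklore] -/
theorem norm_resid_le (hn : 2 ≤ n) (g : {y // S y} → ℂ) (y : {y // S y}) : ‖resid n M S g y‖ ≤ Bsum M S g y := by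
  have hnd : (0 : ℝ) < (n : ℝ) ^ d := pow_pos (by exact_mod_cast Nat.pos_of_ne_zero (NeZero.ne n)) d
  have hcard : (Fintype.card (Fin d → Fin n) : ℝ) = (n : ℝ) ^ d := by
    rw [Fintype.card_fun, Fintype.card_fin, Fintype.card_fin]; push_cast; ring
  -- `r_y = n^{-d} Σ_j Σ_v (g̃ y − G v)·bump_v(bpt y j)`
  have e : resid n M S g y
      = 1 / (n : ℂ) ^ d * ∑ j : Fin d → Fin n, ∑ v : Tor M,
          (ext S g y - vertexVal M S g v) * ((bump n M v (bpt n M y j) : ℝ) : ℂ) := by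
    have hv : ∀ x : Tor (fine n M), ∑ v : Tor M, ext S g y * ((bump n M v x : ℝ) : ℂ) = ext S g y := fun x => by
      rw [← Finset.mul_sum, ← Complex.ofReal_sum, sum_bump, Complex.ofReal_one, mul_one]
    have hcardC : (Fintype.card (Fin d → Fin n) : ℂ) = (n : ℂ) ^ d := by
      rw [Fintype.card_fun, Fintype.card_fin, Fintype.card_fin]; push_cast; ring
    have hn' : ((n : ℂ) ^ d) ≠ 0 := pow_ne_zero _ (by exact_mod_cast NeZero.ne n)
    have hg' : g y = 1 / (n : ℂ) ^ d * ∑ j : Fin d → Fin n, ∑ v : Tor M, ext S g y * ((bump n M v (bpt n M y j) : ℝ) : ℂ) := by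
      simp_rw [hv]
      rw [Finset.sum_const, Finset.card_univ, nsmul_eq_mul, hcardC, ext_apply_of]
      field_simp
    rw [resid, QsOp_mulVec, hg', ← mul_sub, ← Finset.sum_sub_distrib]
    congr 1
    refine Finset.sum_congr rfl fun j _ => ?_
    rw [interp, ← Finset.sum_sub_distrib]
    exact Finset.sum_congr rfl fun v _ => by ring
  rw [e, norm_mul, norm_div, norm_one, norm_pow, Complex.norm_natCast]
  have hterm : ∀ j : Fin d → Fin n,
      ‖∑ v : Tor M, (ext S g y - vertexVal M S g v) * ((bump n M v (bpt n M y j) : ℝ) : ℂ)‖ ≤ Bsum M S g y := by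
    intro j
    calc ‖∑ v : Tor M, (ext S g y - vertexVal M S g v) * ((bump n M v (bpt n M y j) : ℝ) : ℂ)‖
        ≤ ∑ v : Tor M, ‖(ext S g y - vertexVal M S g v) * ((bump n M v (bpt n M y j) : ℝ) : ℂ)‖ := norm_sum_le _ _
      _ ≤ ∑ v : Tor M, Bsum M S g y * bump n M v (bpt n M y j) := by
          refine Finset.sum_le_sum fun v _ => ?_
          have hb := (bump_mem n M hn v (bpt n M y j)).1
          rw [norm_mul, Complex.norm_real, Real.norm_of_nonneg hb]
          by_cases h0 : bump n M v (bpt n M y j) = 0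
          · rw [h0, mul_zero, mul_zero]
          · have hin := inPatch_of_bump_ne_zero n M h0
            rw [blockOf_bpt] at hin
            exact mul_le_mul_of_nonneg_right (norm_sub_vertexVal_le_Bsum M S g hin) hb
      _ = Bsum M S g y := by rw [← Finset.mul_sum, sum_bump, mul_one]
  calc 1 / (n : ℝ) ^ d * ‖∑ j : Fin d → Fin n, ∑ v : Tor M, (ext S g y - vertexVal M S g v) * ((bump n M v (bpt n M y j) : ℝ) : ℂ)‖
      ≤ 1 / (n : ℝ) ^ d * ∑ j : Fin d → Fin n, Bsum M S g y :=
        mul_le_mul_of_nonneg_left ((norm_sum_le _ _).trans (Finset.sum_le_sum fun j _ => hterm j)) (by positivity)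
    _ = Bsum M S g y := by rw [Finset.sum_const, Finset.card_univ, nsmul_eq_mul, hcard]; field_simp

end Summit.QuantumFields.BalabanUV.T4Continuum.RegionBlockExtension

end
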